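import Mathlib
import Summits.ValiantsHypothesis.ValiantsHypothesis.Theorems.NewtonUnitEquationsTwoProductsFormalLogLinearisationTame
import HarnessLib

/-!
# Route NewtonUnitEquations — crux `TwoProducts` (stmt-ValiantsHypothesis-5906): WRONSKIAN DESCENT
# («multiplicity is not a resource»; Theorems port of `Cruxes/TwoProducts/WronskianDescent_val_idea_37_g7.lean`)

Helper mode (`--supports stmt-ValiantsHypothesis-5906 --as helper`).  PORT, near-verbatim (namespace moved from
`…Cruxes.TwoProducts.WronskianDescent` to `…Theorems.NewtonUnitEquations.TwoProducts.WronskianDescent`, docstrings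
completed), of the ideator file `Cruxes/TwoProducts/WronskianDescent_val_idea_37_g7.lean` (val-idea-37 g7, tree
@e6aea1eb341d; critic val-idea-crit-8 g3 VERDICT #29 «THEOREM ACCEPTED (kernel) ★★, class decided, CRITIC FACT F5»,
port recommendation (R-c)).  **Honest framing: VP ≠ VNP is NOT proved; `TwoProducts` (5906), `PlanarCellBound` and the
line of record `Lines/relation_ladder.lean` v25 (`stub_residual`) are OPEN and UNMOVED.  This file decides a SIDE CLASS
(instances whose factors are powers of a bounded family of tails), uniformly in the exponents; it says nothing for
multiplicity-free instances (the γ residual of record).**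

## Content (fully kernel-checked; objects `Expo`, `wt`, `IsStrictTop` of `…FormalLogLinearisationDefs`, tameness toolkit of
## `…FormalLogLinearisationTame`)

Let `w : Fin n → ℂ[x,y]` be tails, `p q : Fin n → ℕ` exponent vectors, `W := ∏ i, (1 + w i) ^ q i − ∏ i, (1 + w i) ^ p i`
(`powProd w q − powProd w p`; an instance of `TwoProducts` with `m = Σ q = Σ p` factors, each repeated), `ξ` a VALID real
weight (`wt ξ e < 0` on every tail exponent), `θ_ξ = Σ_i ξ_i X_i ∂_i` the Euler derivation (`eulerD`), and
`N_ξ := logNum θ_ξ w q − logNum θ_ξ w p` with `logNum θ w p = Σ_i p_i · θ(w_i) · ∏_{j ≠ i} (1 + w_j)` (the numerator of the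
logarithmic derivative of `∏(1+w_i)^{p_i}` over the common denominator `unitProd w = ∏_i (1 + w_i)`).

* `derivation_finset_prod` — Leibniz rule of a derivation over a finite product. [folklore]
* `wronskian_identity` — `unitProd w · (P·θQ − Q·θP) = P·Q·N_θ` for `P = powProd w p`, `Q = powProd w q`, ANY derivation θ.
* `descent` — if `l` is the strict `ξ`-top of `supp W` then `l` is the strict `ξ`-top of `supp N_ξ` and
  `N_ξ[l] = wt ξ l · W[l]` (`P`, `Q`, `unitProd w` are `1 +` negative-weight terms, `θ_ξ` kills the corner, and
  `P·θW − W·θP = P·θQ − Q·θP`).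
* `top_mem_topSet` — hence every valid strict top of `W` lies in the `ξ`-free, EXPONENT-FREE finite set
  `topSet w = ⋃_i (supp w_i + supp ∏_{j≠i}(1+w_j))` (`≤ n·t·(t+1)^{n-1}` points).
* `two_powers_tops` — two tails `a, b`: every valid strict top of `(1+a)^{q₁}(1+b)^{q₂} − (1+a)^{p₁}(1+b)^{p₂}` lies in
  `supp a ∪ supp b ∪ (supp a + supp b)`.

Consequence booked by the critic (F5, on paper from `top_mem_topSet` + the sector count): for instances of `TwoProducts`
whose factor multiset has `≤ n` members up to scalars, `#vertices ≤ 2mt·(1 + n t (t+1)^{n−1}) ≤ 2^m (t+2)^{n+2}` for all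
`m` — an escape family needs an unbounded number of pairwise non-proportional tails.

Source of the lever: the Wronskian uniformity of Koiran–Portier–Tavenas [arXiv:1205.1015, Thm 12] (univariate real
roots, uniform in the exponents), transplanted to Newton polygons through the single identity `wronskian_identity`
(dictionary: real roots ↦ valid strict tops; «multiply by ∏ f_j^{N+k}» ↦ clearing the units `∏(1+w_i)`).  No formal
logarithm, no Puiseux series, no root counting.  No `instance`, no notation, no named literature facts.
-/

set_option linter.dupNamespace false

noncomputable section

open scoped BigOperators Pointwise
open MvPolynomial
open Summit.ValiantsHypothesis.ValiantsHypothesis.Theorems.NewtonUnitEquations.TwoProducts.FormalLogLinearisation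

namespace Summit.ValiantsHypothesis.ValiantsHypothesis.Theorems.NewtonUnitEquations.TwoProducts.WronskianDescent

/-- Bivariate complex polynomials. -/
abbrev Poly := MvPolynomial (Fin 2) ℂ

/-! ## 1. Leibniz over finite products and the log-free Wronskian identity (any derivation) -/

/-- Leibniz rule of a derivation over a finite product. [folklore] -/
theorem derivation_finset_prod {ι : Type*} [DecidableEq ι] (D : Derivation ℂ Poly Poly) (s : Finset ι)
    (f : ι → Poly) : D (∏ i ∈ s, f i) = ∑ i ∈ s, (∏ j ∈ s.erase i, f j) * D (f i) := by
  induction s using Finset.induction_on with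
  | empty => simp
  | insert a s ha ih =>
    rw [Finset.prod_insert ha, D.leibniz, ih, Finset.sum_insert ha, Finset.erase_insert ha, smul_eq_mul,
      smul_eq_mul, Finset.mul_sum, add_comm]
    congr 1
    refine Finset.sum_congr rfl fun i hi => ?_
    have hne : a ≠ i := fun h => ha (h ▸ hi)
    rw [Finset.erase_insert_of_ne hne, Finset.prod_insert fun h => ha (Finset.mem_of_mem_erase h)]
    ring

variable {n : ℕ}

/-- The unit product `∏ i, (1 + w i)` of a tail family. -/
def unitProd (w : Fin n → Poly) : Poly := ∏ i, (1 + w i)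

/-- The power product `∏ i, (1 + w i) ^ p i` of a tail family with exponent vector `p`. -/
def powProd (w : Fin n → Poly) (p : Fin n → ℕ) : Poly := ∏ i, (1 + w i) ^ p i

/-- The cofactor `∏_{j ≠ i} (1 + w j)`. -/
def cof (w : Fin n → Poly) (i : Fin n) : Poly := ∏ j ∈ Finset.univ.erase i, (1 + w j)

/-- Numerator of the logarithmic derivative of `powProd w p` over the common denominator `unitProd w`:
`Σ_i p_i · D(w_i) · ∏_{j ≠ i}(1 + w_j)` — a polynomial of depth one in each tail beyond the differentiated one. -/
def logNum (D : Derivation ℂ Poly Poly) (w : Fin n → Poly) (p : Fin n → ℕ) : Poly :=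
  ∑ i, (p i : ℂ) • (D (w i) * cof w i)

/-- Logarithmic derivative, cleared of denominators: `(∏(1+w_i)) · D(∏(1+w_i)^{p_i}) = ∏(1+w_i)^{p_i} · logNum`.
[folklore] -/
theorem unitProd_mul_D_powProd (D : Derivation ℂ Poly Poly) (w : Fin n → Poly) (p : Fin n → ℕ) :
    unitProd w * D (powProd w p) = powProd w p * logNum D w p := by
  unfold unitProd powProd logNum cof
  rw [derivation_finset_prod D, Finset.mul_sum, Finset.mul_sum]
  refine Finset.sum_congr rfl fun i _ => ?_
  rw [D.leibniz_pow, map_add, Derivation.map_one_eq_zero, zero_add, smul_eq_C_mul, map_natCast,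
    ← Finset.prod_erase_mul Finset.univ (fun j => 1 + w j) (Finset.mem_univ i),
    ← Finset.prod_erase_mul Finset.univ (fun j => (1 + w j) ^ p j) (Finset.mem_univ i)]
  rcases Nat.eq_zero_or_pos (p i) with h0 | hpos
  · simp [h0]
  · obtain ⟨k, hk⟩ : ∃ k, p i = k + 1 := ⟨p i - 1, (Nat.sub_add_cancel hpos).symm⟩
    rw [hk, Nat.add_sub_cancel, pow_succ, nsmul_eq_mul, smul_eq_mul]
    push_cast
    ring

/-- **The log-free Wronskian identity.** For `P = ∏(1+w_i)^{p_i}`, `Q = ∏(1+w_i)^{q_i}` and any derivation `D`: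
`(∏(1+w_i)) · (P · DQ − Q · DP) = P · Q · (logNum_q − logNum_p)`. [folklore] -/
theorem wronskian_identity (D : Derivation ℂ Poly Poly) (w : Fin n → Poly) (p q : Fin n → ℕ) :
    unitProd w * (powProd w p * D (powProd w q) - powProd w q * D (powProd w p)) =
      powProd w p * powProd w q * (logNum D w q - logNum D w p) := by
  have hp := unitProd_mul_D_powProd D w p
  have hq := unitProd_mul_D_powProd D w q
  linear_combination powProd w p * hq - powProd w q * hp

/-! ## 2. The Euler derivation of a real weight -/

/-- `θ_ξ = Σ_i ξ_i X_i ∂_i` (complex scalars), acting on monomials by `X^e ↦ (wt ξ e) X^e`. -/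
def eulerD (ξ : Fin 2 → ℝ) : Derivation ℂ Poly Poly :=
  MvPolynomial.mkDerivation ℂ (fun i : Fin 2 => ((ξ i : ℝ) : ℂ) • (X i : Poly))

/-- The Euler derivation acts diagonally on monomials: `(θ_ξ A)[e] = wt ξ e · A[e]`. [folklore] -/
theorem coeff_eulerD (ξ : Fin 2 → ℝ) (A : Poly) (e : Expo) :
    coeff e (eulerD ξ A) = ((wt ξ e : ℝ) : ℂ) * coeff e A :=
  coeff_eulerDerivation_wt ξ A e

/-- `θ_ξ` does not enlarge supports. [folklore] -/
theorem support_eulerD_subset (ξ : Fin 2 → ℝ) (A : Poly) : (eulerD ξ A).support ⊆ A.support := by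
  intro e he
  rw [mem_support_iff] at he ⊢
  rw [coeff_eulerD] at he
  exact right_ne_zero_of_mul he

/-- A polynomial lying strictly below the strict top `l` of `A` has no `X^l` term. [folklore] -/
theorem coeff_eq_zero_of_below (ξ : Fin 2 → ℝ) {A R : Poly} {l : Expo} (hl : IsStrictTop ξ ↑A.support l)
    (hR : ∀ p ∈ R.support, ∃ q ∈ A.support, wt ξ p < wt ξ q) : coeff l R = 0 := by
  by_contra h
  obtain ⟨q, hq, hlt⟩ := hR l (mem_support_iff.mpr h)
  rcases eq_or_ne q l with rfl | hne
  · exact lt_irrefl _ hlt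
  · exact lt_asymm hlt (hl.2 q (Finset.mem_coe.mpr hq) hne)

/-! ## 3. Top extraction -/

section Extraction

variable (ξ : Fin 2 → ℝ) (w : Fin n → Poly)

/-- The `ξ`-free, exponent-free candidate set for tops: `⋃_i (supp w_i + supp ∏_{j≠i}(1+w_j))`. -/
def topSet (w : Fin n → Poly) : Finset Expo :=
  Finset.univ.biUnion fun i => (w i).support + (cof w i).support

/-- The log-derivative numerator `logNum θ_ξ w p` is supported in the exponent-free set `topSet w`. [folklore] -/
theorem support_logNum_subset (p : Fin n → ℕ) : (logNum (eulerD ξ) w p).support ⊆ topSet w := by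
  classical
  intro e he
  unfold logNum at he
  obtain ⟨i, -, hi⟩ := Finset.mem_biUnion.mp (support_sum he)
  have h2 := support_mul _ _ (support_smul hi)
  exact Finset.mem_biUnion.mpr
    ⟨i, Finset.mem_univ i, Finset.add_subset_add_right (support_eulerD_subset ξ (w i)) h2⟩

/-- **WRONSKIAN DESCENT (top extraction).**  For a tail family `w` and a valid weight `ξ`, every strict `ξ`-top
`l` of `supp (∏(1+w_i)^{q_i} − ∏(1+w_i)^{p_i})` is the strict `ξ`-top of the depth-two polynomial
`N_ξ = logNum θ_ξ w q − logNum θ_ξ w p`, and `N_ξ[l] = (wt ξ l) · W[l]`. -/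
theorem descent (hval : ∀ i, ∀ e ∈ (w i).support, wt ξ e < 0) (p q : Fin n → ℕ) {l : Expo}
    (hl : IsStrictTop ξ ↑(powProd w q - powProd w p).support l) :
    IsStrictTop ξ ↑(logNum (eulerD ξ) w q - logNum (eulerD ξ) w p).support l ∧
      coeff l (logNum (eulerD ξ) w q - logNum (eulerD ξ) w p) =
        ((wt ξ l : ℝ) : ℂ) * coeff l (powProd w q - powProd w p) := by
  classical
  -- (0) a uniform tameness constant; tails are constant-free
  obtain ⟨c, hc, hcT⟩ := exists_tame_const ξ (Finset.univ.biUnion fun i => (w i).support)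
    (fun e he => by
      obtain ⟨i, -, hi⟩ := Finset.mem_biUnion.mp he
      exact hval i e hi)
  have hw : ∀ i, (∀ pp ∈ (w i).support, c * (((pp 0 : ℕ) : ℝ) + ((pp 1 : ℕ) : ℝ)) ≤ -wt ξ pp) := fun i e he =>
    hcT e (Finset.mem_biUnion.mpr ⟨i, Finset.mem_univ i, he⟩)
  have hw0 : ∀ i, coeff 0 (w i) = 0 := fun i => by
    by_contra h
    have := hval i 0 (mem_support_iff.mpr h)
    rw [wt_zero] at this
    exact lt_irrefl _ this
  -- names
  let D := eulerD ξ
  have hDc : ∀ (A : Poly) e, coeff e (D A) = ((wt ξ e : ℝ) : ℂ) * coeff e A := coeff_eulerD ξ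
  have hc0 : ∀ A B : Poly, coeff 0 (A * B) = coeff 0 A * coeff 0 B := fun A B => by
    simp [coeff_mul]
  -- (1) tameness of the players
  have h1w : ∀ i, (∀ pp ∈ (1 + w i).support, c * (((pp 0 : ℕ) : ℝ) + ((pp 1 : ℕ) : ℝ)) ≤ -wt ξ pp) :=
    fun i => tame_add ξ c (tame_one ξ c) (hw i)
  have hU : (∀ pp ∈ (unitProd w).support, c * (((pp 0 : ℕ) : ℝ) + ((pp 1 : ℕ) : ℝ)) ≤ -wt ξ pp) := by
    unfold unitProd; exact tame_prod ξ c _ fun i _ => h1w i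
  have hP : (∀ pp ∈ (powProd w p).support, c * (((pp 0 : ℕ) : ℝ) + ((pp 1 : ℕ) : ℝ)) ≤ -wt ξ pp) := by
    unfold powProd; exact tame_prod ξ c _ fun i _ => tame_pow ξ c (h1w i) (p i)
  have hQ : (∀ pp ∈ (powProd w q).support, c * (((pp 0 : ℕ) : ℝ) + ((pp 1 : ℕ) : ℝ)) ≤ -wt ξ pp) := by
    unfold powProd; exact tame_prod ξ c _ fun i _ => tame_pow ξ c (h1w i) (q i)
  have hWt : (∀ pp ∈ (powProd w q - powProd w p).support, c * (((pp 0 : ℕ) : ℝ) + ((pp 1 : ℕ) : ℝ)) ≤ -wt ξ pp) :=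
    tame_sub ξ c hQ hP
  have hDW : (∀ pp ∈ (D (powProd w q - powProd w p)).support, c * (((pp 0 : ℕ) : ℝ) + ((pp 1 : ℕ) : ℝ)) ≤ -wt ξ pp) :=
    tame_euler ξ c (hDc _) hWt
  have hDP : (∀ pp ∈ (D (powProd w p)).support, c * (((pp 0 : ℕ) : ℝ) + ((pp 1 : ℕ) : ℝ)) ≤ -wt ξ pp) :=
    tame_euler ξ c (hDc _) hP
  -- (2) constant terms
  have h1w0 : ∀ i, coeff 0 (1 + w i) = 1 := fun i => by rw [coeff_add, coeff_zero_one, hw0 i, add_zero]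
  have hU0 : coeff 0 (unitProd w) = 1 := by
    unfold unitProd
    rw [← constantCoeff_eq, map_prod]
    exact Finset.prod_eq_one fun i _ => by rw [constantCoeff_eq]; exact h1w0 i
  have hpow0 : ∀ (r : Fin n → ℕ), coeff 0 (powProd w r) = 1 := fun r => by
    unfold powProd
    rw [← constantCoeff_eq, map_prod]
    exact Finset.prod_eq_one fun i _ => by rw [map_pow, constantCoeff_eq, h1w0 i, one_pow]
  have hW0 : coeff 0 (powProd w q - powProd w p) = 0 := by rw [coeff_sub, hpow0, hpow0, sub_self]
  have hDP0 : coeff 0 (D (powProd w p)) = 0 := by rw [hDc, wt_zero]; simp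
  have hB1_0 : coeff 0 (unitProd w * powProd w p - 1) = 0 := by
    rw [coeff_sub, hc0, hU0, hpow0, coeff_zero_one]; ring
  have hB1t : (∀ pp ∈ (unitProd w * powProd w p - 1).support, c * (((pp 0 : ℕ) : ℝ) + ((pp 1 : ℕ) : ℝ)) ≤ -wt ξ pp) :=
    tame_sub ξ c (tame_mul ξ c hU hP) (tame_one ξ c)
  have hB2_0 : coeff 0 (unitProd w * D (powProd w p)) = 0 := by rw [hc0, hDP0, mul_zero]
  have hB2t : (∀ pp ∈ (unitProd w * D (powProd w p)).support, c * (((pp 0 : ℕ) : ℝ) + ((pp 1 : ℕ) : ℝ)) ≤ -wt ξ pp) :=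
    tame_mul ξ c hU hDP
  have hB3_0 : coeff 0 (powProd w p * powProd w q - 1) = 0 := by
    rw [coeff_sub, hc0, hpow0, hpow0, coeff_zero_one]; ring
  have hB3t : (∀ pp ∈ (powProd w p * powProd w q - 1).support, c * (((pp 0 : ℕ) : ℝ) + ((pp 1 : ℕ) : ℝ)) ≤ -wt ξ pp) :=
    tame_sub ξ c (tame_mul ξ c hP hQ) (tame_one ξ c)
  -- (3) the identity, in the two shapes used
  have hE : unitProd w * (powProd w p * D (powProd w q - powProd w p) -
      (powProd w q - powProd w p) * D (powProd w p)) =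
      powProd w p * powProd w q * (logNum D w q - logNum D w p) := by
    rw [map_sub]
    linear_combination wronskian_identity D w p q
  have hE' : unitProd w * (powProd w p * D (powProd w q - powProd w p) -
      (powProd w q - powProd w p) * D (powProd w p)) =
      D (powProd w q - powProd w p) +
        (D (powProd w q - powProd w p) * (unitProd w * powProd w p - 1) -
          (powProd w q - powProd w p) * (unitProd w * D (powProd w p))) := by
    ring
  have hE2 : unitProd w * (powProd w p * D (powProd w q - powProd w p) -
      (powProd w q - powProd w p) * D (powProd w p)) =
      (logNum D w q - logNum D w p) + (logNum D w q - logNum D w p) * (powProd w p * powProd w q - 1) := by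
    rw [hE]; ring
  -- (4) step one: the left-hand side has strict top `l` with coefficient `wt l · W[l]`
  have hsuppDW : (D (powProd w q - powProd w p)).support = (powProd w q - powProd w p).support :=
    support_euler_eq ξ hc (hDc _) hW0 hWt
  have hR_below : ∀ e ∈ (D (powProd w q - powProd w p) * (unitProd w * powProd w p - 1) -
      (powProd w q - powProd w p) * (unitProd w * D (powProd w p))).support,
      ∃ e' ∈ (D (powProd w q - powProd w p)).support, wt ξ e < wt ξ e' := by
    intro e he
    rcases Finset.mem_union.mp (support_sub _ _ _ he) with h | h
    · exact below_of_support_mul ξ hc _ _ hB1_0 hB1t e h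
    · obtain ⟨e', he', hlt⟩ := below_of_support_mul ξ hc _ _ hB2_0 hB2t e h
      exact ⟨e', by rw [hsuppDW]; exact he', hlt⟩
  have hlDW : IsStrictTop ξ ↑(D (powProd w q - powProd w p)).support l := by
    rw [hsuppDW]; exact hl
  have hlE : IsStrictTop ξ ↑(unitProd w * (powProd w p * D (powProd w q - powProd w p) -
      (powProd w q - powProd w p) * D (powProd w p))).support l := by
    rw [hE']
    exact (isStrictTop_support_add_iff ξ _ _ hR_below l).mpr hlDW
  have hcoeffE : coeff l (unitProd w * (powProd w p * D (powProd w q - powProd w p) -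
      (powProd w q - powProd w p) * D (powProd w p))) =
      ((wt ξ l : ℝ) : ℂ) * coeff l (powProd w q - powProd w p) := by
    rw [hE', coeff_add, coeff_eq_zero_of_below ξ hlDW hR_below, add_zero, hDc]
  -- (5) step two: strip the unit `P · Q`
  have hN_below : ∀ e ∈ ((logNum D w q - logNum D w p) * (powProd w p * powProd w q - 1)).support,
      ∃ e' ∈ (logNum D w q - logNum D w p).support, wt ξ e < wt ξ e' :=
    below_of_support_mul ξ hc _ _ hB3_0 hB3t
  have hlN : IsStrictTop ξ ↑(logNum D w q - logNum D w p).support l := by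
    have h := hlE
    rw [hE2] at h
    exact (isStrictTop_support_add_iff ξ _ _ hN_below l).mp h
  refine ⟨hlN, ?_⟩
  have h := hcoeffE
  rw [hE2, coeff_add, coeff_eq_zero_of_below ξ hlN hN_below, add_zero] at h
  exact h

/-- **Corollary (exponent-free top set).** Every valid strict top of `∏(1+w_i)^{q_i} − ∏(1+w_i)^{p_i}` lies in
`topSet w`, a finite set depending on the tails only — not on `p`, `q`, `ξ`. -/
theorem top_mem_topSet (hval : ∀ i, ∀ e ∈ (w i).support, wt ξ e < 0) (p q : Fin n → ℕ) {l : Expo}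
    (hl : IsStrictTop ξ ↑(powProd w q - powProd w p).support l) : l ∈ topSet w := by
  classical
  have h := (descent ξ w hval p q hl).1.1
  rcases Finset.mem_union.mp (support_sub _ _ _ (Finset.mem_coe.mp h)) with h | h
  · exact support_logNum_subset ξ w q h
  · exact support_logNum_subset ξ w p h

/-- **Corollary (nonvanishing).** At a valid strict top the depth-two polynomial `N_ξ` has the explicit nonzero
coefficient `wt ξ l · W[l]`. -/
theorem coeff_top_ne_zero (hval : ∀ i, ∀ e ∈ (w i).support, wt ξ e < 0) (p q : Fin n → ℕ) {l : Expo}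
    (hl : IsStrictTop ξ ↑(powProd w q - powProd w p).support l) :
    coeff l (logNum (eulerD ξ) w q - logNum (eulerD ξ) w p) ≠ 0 :=
  mem_support_iff.mp (Finset.mem_coe.mp (descent ξ w hval p q hl).1.1)

end Extraction

/-! ## 4. Two tails: pure powers and power-products of two sparse polynomials -/

/-- **Corollary (two tails; the «≥ 2-shift toy» decided).** For tails `a, b` with supports `A, B`, any
exponents `p₁ p₂ q₁ q₂` and any valid weight, every strict top of
`(1+a)^{q₁}(1+b)^{q₂} − (1+a)^{p₁}(1+b)^{p₂}` lies in `A ∪ B ∪ (A + B)` — a set of size `≤ 2t + t²`, independent of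
the exponents.  Pure powers `(1+b)^q − (1+a)^p` are the case `q₁ = p₂ = 0`. -/
theorem two_powers_tops (ξ : Fin 2 → ℝ) (a b : Poly) (ha : ∀ e ∈ a.support, wt ξ e < 0)
    (hb : ∀ e ∈ b.support, wt ξ e < 0) (p₁ p₂ q₁ q₂ : ℕ) {l : Expo}
    (hl : IsStrictTop ξ ↑((1 + a) ^ q₁ * (1 + b) ^ q₂ - (1 + a) ^ p₁ * (1 + b) ^ p₂).support l) :
    l ∈ a.support ∪ b.support ∪ (a.support + b.support) := by
  classical
  have hval : ∀ i, ∀ e ∈ ((![a, b] : Fin 2 → Poly) i).support, wt ξ e < 0 := by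
    intro i e he
    rcases (Fin.exists_fin_two (p := fun j => e ∈ ((![a, b] : Fin 2 → Poly) j).support)).mp ⟨i, he⟩
      with h | h
    · exact ha e (by simpa using h)
    · exact hb e (by simpa using h)
  have hW : powProd ![a, b] ![q₁, q₂] - powProd ![a, b] ![p₁, p₂] =
      (1 + a) ^ q₁ * (1 + b) ^ q₂ - (1 + a) ^ p₁ * (1 + b) ^ p₂ := by
    simp [powProd, Fin.prod_univ_two]
  have hmem := top_mem_topSet ξ ![a, b] hval ![p₁, p₂] ![q₁, q₂] (by rw [hW]; exact hl)
  unfold topSet at hmem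
  obtain ⟨i, -, hi⟩ := Finset.mem_biUnion.mp hmem
  have he0 : Finset.univ.erase (0 : Fin 2) = {1} := by decide
  have he1 : Finset.univ.erase (1 : Fin 2) = {0} := by decide
  have hcof0 : cof ![a, b] 0 = 1 + b := by unfold cof; rw [he0, Finset.prod_singleton]; simp
  have hcof1 : cof ![a, b] 1 = 1 + a := by unfold cof; rw [he1, Finset.prod_singleton]; simp
  have h1s : ∀ (c : Poly) (β : Expo), β ∈ (1 + c).support → β = 0 ∨ β ∈ c.support := by
    intro c β hβ
    rcases Finset.mem_union.mp (support_add hβ) with h | h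
    · left; rw [support_one, Finset.mem_singleton] at h; exact h
    · right; exact h
  rcases (Fin.exists_fin_two
      (p := fun j => l ∈ ((![a, b] : Fin 2 → Poly) j).support + (cof ![a, b] j).support)).mp ⟨i, hi⟩
    with h | h
  · rw [hcof0] at h
    simp only [Matrix.cons_val_zero] at h
    obtain ⟨α, hα, β, hβ, rfl⟩ := Finset.mem_add.mp h
    rcases h1s b β hβ with rfl | hB
    · rw [add_zero]
      exact Finset.mem_union_left _ (Finset.mem_union_left _ hα)
    · exact Finset.mem_union_right _ (Finset.add_mem_add hα hB)
  · rw [hcof1] at h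
    simp only [Matrix.cons_val_one] at h
    obtain ⟨β, hβ, α, hα, rfl⟩ := Finset.mem_add.mp h
    rcases h1s a α hα with rfl | hA
    · rw [add_zero]
      exact Finset.mem_union_left _ (Finset.mem_union_right _ hβ)
    · rw [add_comm β α]
      exact Finset.mem_union_right _ (Finset.add_mem_add hA hβ)

end Summit.ValiantsHypothesis.ValiantsHypothesis.Theorems.NewtonUnitEquations.TwoProducts.WronskianDescent

end
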